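import Summits.BirchSwinnertonDyer.BirchSwinnertonDyer.Theorems.ManinLocalTwoThreeConductorExponentThreeAtTwo
import Literature.NumberTheory.EllipticCurves.KodairaDiscriminantValuesTwoProofs
import Literature.NumberTheory.DiophantineGeometry.TateAlgorithmIstarSuccNormalFormProofs
import HarnessLib

/-!
# The additive types with `f₂ = 4`: `II/4`, `I₀*/8`, `I₂*/10`, `I₃*/11`, `I₄*/12`, `II*/12`, `Iₙ*/(n+8)` (`n ≥ 5`) — and `I₁*` at `2`
# never has `ord₂ Δ_min = 9` (route `ManinLocalTwoThree`, crux C2 `ManinOddAtFour` stmt-BirchSwinnertonDyer-22967; cell bsd-f2-manin,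
# step 1 of an's candidate S-an-63 «16 ∥ N descends» per the p2 g13 HANDOFF recipe; p3 gen 12)

Companion of p2's `…ConductorExponentThreeAtTwo` (the `f₂ = 3` list).  With the tree's Ogg-as-definition `f = ord Δ_min + 1 − m`, `f = 4`
pins `ord Δ_min = m + 3` for each Kodaira type; the tree's value sets at an absolutely unramified `2`-adic place
(`KodairaDiscriminantValuesTwoProofs`: `II ∈ {4,6,7}`, `III ∈ {4,6,8,9}`, `IV = 4`, `I₀* ∈ {8,9,10}`, `IV* = 8`, `III* ∈ {10,12,14,15}`,
`II* ∈ {11,12,14}`) exclude `III`, `IV`, `IV*`, `III*`; §1 supplies the one missing exclusion, **`I₁*` with `ord Δ = 9`**: on the tree's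
`Iₙ*` normal form (`2 ∣ a₁`, `2 ∥ a₂`, `4 ∣ a₃`, `8 ∣ a₄`, `16 ∣ a₆`) either `4 ∥ a₃` and then `Δ = 2⁸(−27(γ² + 4ε)² + 2Y)` has
`ord Δ = 8` EXACTLY (`addVal_Δ_toNat_of_istarSuccForm_of_isUnit`), or `8 ∣ a₃` and `2¹⁰ ∣ Δ` (`pow_ten_dvd_Δ_of_istarSuccForm_of_dvd`).
§2–§3: the `f₂ = 4` list over a Dedekind domain / over `ℚ` (`kodairaSymbolAt_of_conductorExponent_eq_four_two`) and
`conductorExponent_ne_four_of_kodairaSymbolAt_eq_Istar_one_two`.  Cremona's table (`N ≤ 10⁵`, this seat's tally from `allcurves`) meets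
every surviving branch (II/4: 11 840, I₀*/8: 15 945, v = 10: 8 331, v = 11: 6 379, v = 12: 9 818, `Iₙ*`, `n ≥ 5`: down to single curves at
`n = 78`) and shows no `f₂ = 4` curve with `m = 6`, as §1 proves.

USE (p2 g13 HANDOFF «NOT DONE / NEXT (i)»): S-an-63 `SixteenExactDescends` / `conductorExponent_quadraticTwist_two_of_eq_four` («f₂ = 4 ⟹
f₂(W ⊗ d) ≤ 3 for d ≡ 3 (4)») is now a case analysis over exactly these seven rows (twist targets, by Barrios et al. 2025 Thm. 5.1:
II → III/IV, I₀* → I₁*/IV*, I₂* → III*, I₃* → II*, I₄* → I₀, II* → I₀, Iₙ≥5* → I_{n−4}).  HONEST FRAMING: local bookkeeping in print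
(Papadopoulos 1993 Table IV), kernel-checked; nothing about BSD or Manin's conjecture is proved; C2 OPEN.
[cite: SilvermanATAEC1994, IV.9.4 Step 7 and Table 4.1 (PDF pp. 345–346, 365)] [cite: Papadopoulos1993, Table IV (p = 2)]
[cite: BarriosEtAl2025, Thm. 5.1 (arXiv:2501.03209 pp. 15–16), rows with f = 4]
-/

set_option autoImplicit false
-- lint-debt: the directory name repeats the summit name (sibling precedent `ManinLocalTwoThreeConductorExponentThreeAtTwo.lean`)
set_option linter.dupNamespace false

noncomputable section

open Polynomial IsLocalRing
open IsDiscreteValuationRing hiding maximalIdeal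
open Literature.NumberTheory.DiophantineGeometry Literature.NumberTheory.DiophantineGeometry.TateAlgorithm
  Literature.NumberTheory.DiophantineGeometry.TateAlgorithm.CharTwo Literature.NumberTheory.EllipticCurves

namespace Summit.BirchSwinnertonDyer.BirchSwinnertonDyer.Theorems.ManinLocalTwoThree

/-! ## §1 The `I₁*` normal form when `2` is a uniformiser: `ord Δ = 8` or `ord Δ ≥ 10`, never `9` -/

section Loop

variable {R : Type*} [CommRing R] [IsDomain R] [IsDiscreteValuationRing R]

/-- **`ord Δ = 8` on the `Iₙ*` (`n ≥ 1`) normal form with `4 ∥ a₃`** (`2` a uniformiser): on `[2α, 2β, 4γ, 8δ, 16ε]` with `γ` a unit,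
`Δ = 2⁸ · (−27 (γ² + 4ε)² + 2·Y)`, and `27`, `γ² + 4ε` are units. [cite: SilvermanATAEC1994, IV.9.4 Step 7 and Table 4.1] -/
theorem addVal_Δ_toNat_of_istarSuccForm_of_isUnit (h2 : Irreducible (2 : R)) (W : WeierstrassCurve R) {α β γ δ ε : R}
    (h₁ : W.a₁ = 2 * α) (h₂ : W.a₂ = 2 * β) (h₃ : W.a₃ = 4 * γ) (h₄ : W.a₄ = 8 * δ) (h₆ : W.a₆ = 16 * ε)
    (hγ : IsUnit γ) : (addVal R W.Δ).toNat = 8 := by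
  have h27 : IsUnit (27 : R) := by
    have := isUnit_add_mul_of_isUnit h2 isUnit_one (13 : R)
    rw [show (1 : R) + 2 * 13 = 27 by norm_num] at this
    exact this
  have hu₆ : IsUnit (γ ^ 2 + 2 * (2 * ε)) := isUnit_add_mul_of_isUnit h2 (hγ.pow 2) _
  refine addVal_toNat_eq_of_eq_add h2 (c := 1) (n := 8) (u := -(27 * (γ ^ 2 + 2 * (2 * ε)) ^ 2))
    (y := -2 * α ^ 6 * ε + 2 * α ^ 5 * γ * δ - α ^ 4 * β * γ ^ 2 - 12 * α ^ 4 * β * ε + 2 * α ^ 4 * δ ^ 2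
      + 8 * α ^ 3 * β * γ * δ + α ^ 3 * γ ^ 3 + 36 * α ^ 3 * γ * ε - 4 * α ^ 2 * β ^ 2 * γ ^ 2 - 24 * α ^ 2 * β ^ 2 * ε
      + 8 * α ^ 2 * β * δ ^ 2 - 30 * α ^ 2 * γ ^ 2 * δ + 72 * α ^ 2 * δ * ε + 8 * α * β ^ 2 * γ * δ + 18 * α * β * γ ^ 3
      + 72 * α * β * γ * ε - 96 * α * γ * δ ^ 2 - 4 * β ^ 3 * γ ^ 2 - 16 * β ^ 3 * ε + 8 * β ^ 2 * δ ^ 2 + 36 * β * γ ^ 2 * δ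
      + 144 * β * δ * ε - 64 * δ ^ 3)
    isUnit_one (h27.mul (hu₆.pow 2)).neg ?_
  simp only [WeierstrassCurve.Δ, WeierstrassCurve.b₂, WeierstrassCurve.b₄, WeierstrassCurve.b₆, WeierstrassCurve.b₈,
    h₁, h₂, h₃, h₄, h₆]
  ring

omit [IsDomain R] [IsDiscreteValuationRing R] in
/-- **`2¹⁰ ∣ Δ` on the `Iₙ*` normal form with `8 ∣ a₃`** (`2` a uniformiser): on `[2α, 2β, 8γ, 8δ, 16ε]` every term of
`Δ = −b₂²b₈ − 8b₄³ − 27b₆² + 9b₂b₄b₆` is divisible by `2¹⁰`. [cite: SilvermanATAEC1994, IV.9.4 Step 7] -/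
theorem pow_ten_dvd_Δ_of_istarSuccForm_of_dvd (W : WeierstrassCurve R) {α β γ δ ε : R}
    (h₁ : W.a₁ = 2 * α) (h₂ : W.a₂ = 2 * β) (h₃ : W.a₃ = 8 * γ) (h₄ : W.a₄ = 8 * δ) (h₆ : W.a₆ = 16 * ε) :
    (2 : R) ^ 10 ∣ W.Δ := by
  refine ⟨-α ^ 6 * ε + 2 * α ^ 5 * γ * δ - 2 * α ^ 4 * β * γ ^ 2 - 6 * α ^ 4 * β * ε + α ^ 4 * δ ^ 2 + 8 * α ^ 3 * β * γ * δ
      + 4 * α ^ 3 * γ ^ 3 + 36 * α ^ 3 * γ * ε - 8 * α ^ 2 * β ^ 2 * γ ^ 2 - 12 * α ^ 2 * β ^ 2 * ε + 4 * α ^ 2 * β * δ ^ 2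
      - 60 * α ^ 2 * γ ^ 2 * δ + 36 * α ^ 2 * δ * ε + 8 * α * β ^ 2 * γ * δ + 72 * α * β * γ ^ 3 + 72 * α * β * γ * ε
      - 96 * α * γ * δ ^ 2 - 8 * β ^ 3 * γ ^ 2 - 8 * β ^ 3 * ε + 4 * β ^ 2 * δ ^ 2 + 72 * β * γ ^ 2 * δ + 72 * β * δ * ε
      - 108 * γ ^ 4 - 216 * γ ^ 2 * ε - 32 * δ ^ 3 - 108 * ε ^ 2, ?_⟩
  simp only [WeierstrassCurve.Δ, WeierstrassCurve.b₂, WeierstrassCurve.b₄, WeierstrassCurve.b₆, WeierstrassCurve.b₈,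
    h₁, h₂, h₃, h₄, h₆]
  ring

/-- **Type `Iₙ*` with `n ≥ 1` never has `ord Δ = 9` when `2` is a uniformiser** (perfect residue field): on the tree's `Iₙ*` normal form
(`exists_smul_of_kodairaSymbolOfMinimal_eq_Istar_succ`: `2 ∣ a₁`, `2 ∥ a₂`, `4 ∣ a₃`, `8 ∣ a₄`, `16 ∣ a₆`) either `4 ∥ a₃` and `ord Δ = 8`
(the `I₁*` exit) or `8 ∣ a₃` and `ord Δ ≥ 10`.  In particular `I₁*` at `2` has `f = ord Δ + 1 − 6 ≠ 4`.
[cite: SilvermanATAEC1994, IV.9.4 Step 7 and Table 4.1] [cite: Papadopoulos1993, Table IV (p = 2)] -/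
theorem addVal_Δ_toNat_ne_nine_of_kodairaSymbolOfMinimal_eq_Istar_succ [PerfectField (ResidueField R)]
    (h2 : Irreducible (2 : R)) (V : WeierstrassCurve R) (hΔ0 : V.Δ ≠ 0) {n : ℕ}
    (hV : V.kodairaSymbolOfMinimal = .Istar (n + 1)) : (addVal R V.Δ).toNat ≠ 9 := by
  obtain ⟨D, h₁, h₂, -, h₃, h₄, h₆⟩ := exists_smul_of_kodairaSymbolOfMinimal_eq_Istar_succ V hV
  have hm : ∀ {x : R}, x ∈ maximalIdeal R ↔ (2 : R) ∣ x := fun {x} ↦ mem_maximalIdeal_iff_dvd_of_irreducible h2 x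
  have hmn : ∀ {x : R} {k : ℕ}, x ∈ maximalIdeal R ^ k ↔ (2 : R) ^ k ∣ x := fun {x k} ↦
    mem_maximalIdeal_pow_iff_dvd_of_irreducible h2 x k
  obtain ⟨α, hα⟩ := hm.mp h₁
  obtain ⟨β, hβ⟩ := hm.mp h₂
  obtain ⟨γ, hγ⟩ := hmn.mp h₃
  obtain ⟨δ, hδ⟩ := hmn.mp h₄
  obtain ⟨ε, hε⟩ := hmn.mp h₆
  rw [← addVal_Δ_smul_toNat D V]
  have hΔ0' : (D • V).Δ ≠ 0 := by
    rw [WeierstrassCurve.variableChange_Δ]; exact mul_ne_zero (by simp) hΔ0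
  by_cases hγu : IsUnit γ
  · rw [addVal_Δ_toNat_of_istarSuccForm_of_isUnit h2 (D • V) hα hβ (by rw [hγ]; ring) (by rw [hδ]; ring)
      (by rw [hε]; ring) hγu]
    norm_num
  · obtain ⟨γ', hγ'⟩ : (2 : R) ∣ γ := by
      have : γ ∈ maximalIdeal R := (IsLocalRing.mem_maximalIdeal _).mpr hγu
      exact hm.mp this
    have h10 := pow_ten_dvd_Δ_of_istarSuccForm_of_dvd (D • V) hα hβ (γ := γ') (by rw [hγ, hγ']; ring)
      (by rw [hδ]; ring) (by rw [hε]; ring)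
    have := le_addVal_toNat_of_pow_dvd h2 hΔ0' h10
    omega

end Loop

/-! ## §2 The additive types with `f = 4` when `2` is a uniformiser -/

section Local

open IsDedekindDomain

variable {A : Type*} [CommRing A] [IsDedekindDomain A] {K : Type*} [Field K] [Algebra A K] [IsFractionRing A K]
  (v : HeightOneSpectrum A) (W : WeierstrassCurve K)

/-- **The additive types with `f_v = 4` at an absolutely unramified `2`-adic place are `II` (`ord_v(Δ_min) = 4`), `I₀*` (`8`),
`I₂*` (`10`), `I₃*` (`11`), `I₄*` (`12`), `II*` (`12`) and `Iₙ*` with `n ≥ 5` (`n + 8`)** (`2` a uniformiser of `O_v`, perfect residue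
field, `W` elliptic).  Exclusions: `III ∈ {4,6,8,9} ∌ 5`, `IV = 4 ≠ 6`, `I₁* ≠ 9` (§1), `IV* = 8 ≠ 10`, `III* ∈ {10,12,14,15} ∌ 11`;
for `Iₙ*`, `n ≥ 2`, the tree's definition `f = ord Δ + 1 − (n + 5)` pins `ord Δ = n + 8`.
[cite: SilvermanATAEC1994, IV.9.4 and Table 4.1] [cite: Papadopoulos1993, Table IV (p = 2)] -/
theorem kodairaSymbolAt_of_conductorExponent_eq_four_of_irreducible_two [W.IsElliptic]
    [PerfectField (IsLocalRing.ResidueField (v.adicCompletionIntegers K))]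
    (h2 : Irreducible (2 : v.adicCompletionIntegers K)) (hf : W.conductorExponent v = 4) :
    (W.kodairaSymbolAt v = .II ∧ W.ordMinimalDiscriminant v = 4) ∨
      (W.kodairaSymbolAt v = .Istar 0 ∧ W.ordMinimalDiscriminant v = 8) ∨
      (W.kodairaSymbolAt v = .Istar 2 ∧ W.ordMinimalDiscriminant v = 10) ∨
      (W.kodairaSymbolAt v = .Istar 3 ∧ W.ordMinimalDiscriminant v = 11) ∨
      (W.kodairaSymbolAt v = .Istar 4 ∧ W.ordMinimalDiscriminant v = 12) ∨
      (W.kodairaSymbolAt v = .IIstar ∧ W.ordMinimalDiscriminant v = 12) ∨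
      (∃ n : ℕ, W.kodairaSymbolAt v = .Istar (n + 5) ∧ W.ordMinimalDiscriminant v = n + 13) := by
  have hadd : (W.kodairaSymbolAt v).IsAdditive :=
    (W.isAdditive_kodairaSymbolAt_iff_holds v).mpr ((W.two_le_conductorExponent_iff_holds v).mp (by omega))
  have hΔ0 := W.localMinimalIntegralModel_Δ_ne_zero v
  have hf' := hf
  unfold WeierstrassCurve.conductorExponent WeierstrassCurve.numComponentsAt at hf'
  -- types `IV`, `IV*`: `ord Δ = 4`, `8`
  have hIV : W.kodairaSymbolAt v = .IV → W.ordMinimalDiscriminant v = 4 := fun hT ↦ by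
    rw [WeierstrassCurve.kodairaSymbolAt_def] at hT
    obtain ⟨D, -, -, -, -, -, hΔ⟩ := LocalIndex.exists_smul_a_of_kodairaSymbolOfMinimal_eq_IV_of_two h2 _ hT
    rw [addVal_Δ_smul_toNat] at hΔ
    exact hΔ
  have hIVs : W.kodairaSymbolAt v = .IVstar → W.ordMinimalDiscriminant v = 8 := fun hT ↦ by
    rw [WeierstrassCurve.kodairaSymbolAt_def] at hT
    obtain ⟨D, -, -, -, -, -, hΔ⟩ := LocalIndex.exists_smul_a_of_kodairaSymbolOfMinimal_eq_IVstar_of_two h2 _ hT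
    rw [addVal_Δ_smul_toNat] at hΔ
    exact hΔ
  -- type `I₁*`: `ord Δ ≠ 9`
  have hI1 : W.kodairaSymbolAt v = .Istar 1 → W.ordMinimalDiscriminant v ≠ 9 := fun hT ↦ by
    rw [WeierstrassCurve.kodairaSymbolAt_def] at hT
    exact addVal_Δ_toNat_ne_nine_of_kodairaSymbolOfMinimal_eq_Istar_succ h2 _ hΔ0 hT
  generalize hT : W.kodairaSymbolAt v = T at hadd hf' hIV hIVs hI1
  have hV : (W.localMinimalIntegralModel v).kodairaSymbolOfMinimal = T := by
    rw [← WeierstrassCurve.kodairaSymbolAt_def]; exact hT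
  cases T with
  | I n => exact absurd hadd (KodairaSymbol.not_isAdditive_I n)
  | II =>
    rw [show KodairaSymbol.numComponents .II = 1 from rfl] at hf'
    exact Or.inl ⟨rfl, by omega⟩
  | III =>
    exfalso
    have h := LocalIndex.addVal_Δ_toNat_eq_of_kodairaSymbolOfMinimal_eq_III_of_two h2 _ hV
    change W.ordMinimalDiscriminant v = 4 ∨ W.ordMinimalDiscriminant v = 6 ∨ W.ordMinimalDiscriminant v = 8 ∨
      W.ordMinimalDiscriminant v = 9 at h
    rw [show KodairaSymbol.numComponents .III = 2 from rfl] at hf'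
    omega
  | IV =>
    exfalso
    have h := hIV rfl
    rw [show KodairaSymbol.numComponents .IV = 3 from rfl] at hf'
    omega
  | Istar n =>
    rw [KodairaSymbol.numComponents_Istar] at hf'
    match n, hf', hI1 with
    | 0, hf', _ => exact Or.inr (Or.inl ⟨rfl, by omega⟩)
    | 1, hf', hI1 => exact absurd (by omega) (hI1 rfl)
    | 2, hf', _ => exact Or.inr (Or.inr (Or.inl ⟨rfl, by omega⟩))
    | 3, hf', _ => exact Or.inr (Or.inr (Or.inr (Or.inl ⟨rfl, by omega⟩)))
    | 4, hf', _ => exact Or.inr (Or.inr (Or.inr (Or.inr (Or.inl ⟨rfl, by omega⟩))))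
    | n + 5, hf', _ => exact Or.inr (Or.inr (Or.inr (Or.inr (Or.inr (Or.inr ⟨n, rfl, by omega⟩)))))
  | IVstar =>
    exfalso
    have h := hIVs rfl
    rw [show KodairaSymbol.numComponents .IVstar = 7 from rfl] at hf'
    omega
  | IIIstar =>
    exfalso
    have h := LocalIndex.addVal_Δ_toNat_eq_of_kodairaSymbolOfMinimal_eq_IIIstar_of_two h2 _ hV
    change W.ordMinimalDiscriminant v = 10 ∨ W.ordMinimalDiscriminant v = 12 ∨ W.ordMinimalDiscriminant v = 14 ∨
      W.ordMinimalDiscriminant v = 15 at h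
    rw [show KodairaSymbol.numComponents .IIIstar = 8 from rfl] at hf'
    omega
  | IIstar =>
    rw [show KodairaSymbol.numComponents .IIstar = 9 from rfl] at hf'
    exact Or.inr (Or.inr (Or.inr (Or.inr (Or.inr (Or.inl ⟨rfl, by omega⟩)))))

end Local

/-! ## §3 Over `ℚ` at the place of `ℤ` above `2` -/

section Rat

open IsDedekindDomain

/-- **`f₂ = 4` over `ℚ` forces `II/4`, `I₀*/8`, `I₂*/10`, `I₃*/11`, `I₄*/12`, `II*/12` or `Iₙ*/(n + 8)` with `n ≥ 5`** (type / `ord₂ Δ_min`,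
place `v` of `ℤ` above `2`).  Cremona's table (`N ≤ 10⁵`, this seat's tally) meets every branch: 11 840 / 15 945 / 8 331 / 6 379 /
9 818 (`I₄*` ∪ `II*`) / and `Iₙ*`, `n ≥ 5`, down to single classes at `n = 78`; no `I₁*` with `f₂ = 4` occurs, as §1 proves.
[cite: SilvermanATAEC1994, IV.9.4 and Table 4.1] [cite: Papadopoulos1993, Table IV (p = 2)] -/
theorem kodairaSymbolAt_of_conductorExponent_eq_four_two (W : WeierstrassCurve ℚ) [W.IsElliptic] (v : HeightOneSpectrum ℤ)
    (hv : Rat.HeightOneSpectrum.natGenerator v = 2) (hf : W.conductorExponent v = 4) :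
    (W.kodairaSymbolAt v = .II ∧ W.ordMinimalDiscriminant v = 4) ∨
      (W.kodairaSymbolAt v = .Istar 0 ∧ W.ordMinimalDiscriminant v = 8) ∨
      (W.kodairaSymbolAt v = .Istar 2 ∧ W.ordMinimalDiscriminant v = 10) ∨
      (W.kodairaSymbolAt v = .Istar 3 ∧ W.ordMinimalDiscriminant v = 11) ∨
      (W.kodairaSymbolAt v = .Istar 4 ∧ W.ordMinimalDiscriminant v = 12) ∨
      (W.kodairaSymbolAt v = .IIstar ∧ W.ordMinimalDiscriminant v = 12) ∨
      (∃ n : ℕ, W.kodairaSymbolAt v = .Istar (n + 5) ∧ W.ordMinimalDiscriminant v = n + 13) :=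
  kodairaSymbolAt_of_conductorExponent_eq_four_of_irreducible_two v W
    (irreducible_two_adicCompletionIntegers_of_natGenerator_eq_two v hv) hf

/-- **`I₁*` at `2` over `ℚ` has `f₂ ≠ 4`** (indeed `ord₂ Δ_min = 8`, `f₂ = 3`, or it is not `I₁*`). [cite: SilvermanATAEC1994, IV.9.4 Step 7] -/
theorem conductorExponent_ne_four_of_kodairaSymbolAt_eq_Istar_one_two (W : WeierstrassCurve ℚ) [W.IsElliptic]
    (v : HeightOneSpectrum ℤ) (hv : Rat.HeightOneSpectrum.natGenerator v = 2) (hT : W.kodairaSymbolAt v = .Istar 1) :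
    W.conductorExponent v ≠ 4 := by
  intro hf
  rcases kodairaSymbolAt_of_conductorExponent_eq_four_two W v hv hf with
    ⟨h, -⟩ | ⟨h, -⟩ | ⟨h, -⟩ | ⟨h, -⟩ | ⟨h, -⟩ | ⟨h, -⟩ | ⟨n, h, -⟩ <;> rw [hT] at h <;> cases h

end Rat

end Summit.BirchSwinnertonDyer.BirchSwinnertonDyer.Theorems.ManinLocalTwoThree

end
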